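import Summits.QuantumFields.BalabanUV.T4Continuum.Support.B13HistMeasurable
import Summits.QuantumFields.BalabanUV.T4Continuum.Support.ActivityTermDatum

/-!
# B13HistReadout — row O1-c (HISTORY ∕ TABLES) of the NE5 crux O1, part 5: the HISTORY READ-OUT of a (2.14)-term datum THROUGH the
# measurable history space — P2's `ReadAdditive` ∕ `ReadUnitBound` and the junction's `LinearHistoryOn.read ∕ histm` clauses BY
# CONSTRUCTION (cell `pub-balaban`, T⁴ fan-out, `HOME/t4/b2b-balaban-t4-ne5-p1/O1-CLAIM-TABLE-NE5-P1.md` row O1-c; design v0.2 R3 ∕ Q1)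

Unit `b2b-balaban-t4-ne5-formalise-leaf-06` (NE5 formalisation swarm, leaf prover 06).  Summits-side NEW WORK under the LEAN
PLACEMENT RULE (cell modelling + bookkeeping; nothing of the manuscripts under audit is asserted).  HONEST FRAMING: rung (B)+1 of the
FINITE-VOLUME T⁴ continuum programme — NOT infinite volume, NOT a mass gap, NOT the Clay problem, NOT a proof of NE5 (NOT PRINTED;
cell GAPS G-t4-U3-1).  HONEST DEPENDENCY (cell line, verbatim): continuum YM on T⁴ ⇐ BetaPertH ∧ nine spine estimates (0/9 proved);
BetaPertH ⇐ (D1) ∧ (D4) ∧ CAP+tail; G-an2-4 gates asym, D1 and NE2/3/4.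

WHY (the glue between three landed modules, no estimate).  Route P2's term format `ActivityTermDatum.TermDatum` (p195577) reads the
inserted history through `read : Hist → 𝒴 → Ω → ℂ` under the weights `τ(Y)` ([II] (2.14) p. 15: the potentials enter through
`exp[Σ_{Y∈𝐃} τ(Y)𝐕_k(Y, B)]`; (1.23) p. 7 ∕ (1.33) p. 9: linearly), normed by the one-run shapes `T4ActivityTiltHistory.ReadAdditive` ∕
`ReadUnitBound`; the O1-d2 junction `B13StepTermExpLinear.LinearHistoryOn` (p208225) asks that `read h Y x = L Y x h` for a CLM family `L`
and that `x ↦ histForm y x` be a.e.-strongly measurable for EVERY `y : Hist`.  With `Hist := B13HistM P` (part 3) and the read-out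
"the `V″`-entry of the table at the domain `dom Y` and the field configuration `B Y x`" all four clauses hold BY CONSTRUCTION:
* §1 `VppCLMM` (the `V″` read-out as a CLM on the measurable space; norm `≤ level136`), `readVpp P dom B h Y x := VppM h (dom Y) (B Y x)`,
  `readVpp_eq_clm` (= `LinearHistoryOn.read` with `L Y x := VppCLMM (dom Y) (B Y x)`), `readAdditive_readVpp` (P2's `ReadAdditive`),
  `readUnitBound_readVpp` (P2's `ReadUnitBound` with `v Y := ϱ·‖τ Y‖·level136(d (dom Y))` — the (1.36) × (2.18) format; in print
  `|τ(Y)||𝐕″_k(Y,B)| ≤ α₄e^{−δκd_k(Y)}`, p. 16, KIND only), `measurable_readVpp` (in `x`, for measurable field maps);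
* §2 for ANY term datum `𝔱 : TermDatum Op (B13HistM P) …` whose `read` IS `readVpp`: `aestronglyMeasurable_histForm` — the `histm`
  clause of `LinearHistoryOn` for EVERY table `y` (it is here that the measurable subspace is needed; on the unrestricted `B13Hist P`
  the clause fails), and `norm_histForm_le` (`‖histForm y x‖ ≤ ‖y‖·Σ_{Y∈𝐃} ‖τ Y‖·level136`).
DESIGN REMARK (Q1 ∕ R3, recorded, no claim): P2's format reads the quadratic-form kernel `Q(Y, B; b, b′)` on the OPERATOR side (`kQ o x`
modifies the Gaussian) because `Σ|τ||½⟨QB,B⟩|` is NOT uniform in the field ((2.19)–(2.21) p. 16 absorb it into the covariance);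
accordingly only the `V″`-read-out is offered as a `read` here — a table's `Q`-entries, if an instancer routes them through `Hist`,
enter the Gaussian side, not `ReadUnitBound`.  WHAT IS NOT HERE: no estimate of [II]; no term datum of Bałaban's (row O1-d2); no
claim about which split the instance uses.  0 sorry; axioms ⊆ {propext, Classical.choice, Quot.sound}.
-/

noncomputable section

open scoped BigOperators
open Finset MeasureTheory

namespace Summit.QuantumFields.BalabanUV.T4Continuum.B13HistReadout

open Literature.MathematicalPhysics.QuantumFieldTheory.Balaban1983to89
open Literature.MathematicalPhysics.QuantumFieldTheory.Balaban1983to89.T4OutputRate (Carriers)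
open Literature.MathematicalPhysics.QuantumFieldTheory.Balaban1983to89.T4ActivityTiltHistory (histPot ReadAdditive ReadUnitBound)
open Summit.QuantumFields.BalabanUV.T4Continuum.ActivityTermModel (TermDatum)
open Summit.QuantumFields.BalabanUV.T4Continuum.B13HistDatum
open Summit.QuantumFields.BalabanUV.T4Continuum.B13HistMeasurable

variable {C : Carriers}

variable (P : MeasPotFrame C)

/-! ## §1 The `V″`-read-out through the measurable history space -/

/-- [folklore] `V″(Y, φ)` as a bounded linear functional on the MEASURABLE history space (restriction of part 1's `VppCLM`). -/
def VppCLMM (Y : C.Dom) (φ : P.Arg Y) : B13HistM P →L[ℂ] ℂ := (P.VppCLM Y φ).comp P.measTables.subtypeL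

/-- [folklore] `VppCLMM` evaluates to `VppM`. -/
@[simp] theorem VppCLMM_apply (Y : C.Dom) (φ : P.Arg Y) (h : B13HistM P) : VppCLMM P Y φ h = P.VppM h Y φ := by
  simp [VppCLMM, MeasPotFrame.VppM]

/-- [folklore] `‖VppCLMM Y φ‖ ≤` the (1.36) format at `Y`. -/
theorem norm_VppCLMM_le (Y : C.Dom) (φ : P.Arg Y) : ‖VppCLMM P Y φ‖ ≤ level136 P.consts (C.d Y) :=
  ContinuousLinearMap.opNorm_le_bound _ (level136_pos P.pos _).le fun h => by
    rw [VppCLMM_apply]; exact P.norm_VppM_le h Y φ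

variable {𝒴 Ω : Type*}

/-- [folklore] THE HISTORY READ-OUT OF A (2.14)-TERM THROUGH THE TABLE: at the term's domain label `Y` (sitting at the carrier domain
`dom Y`) and integration point `x` (carrying the field configuration `B Y x` on that domain), read the `V″`-entry of the table. -/
def readVpp (dom : 𝒴 → C.Dom) (B : (Y : 𝒴) → Ω → P.Arg (dom Y)) (h : B13HistM P) (Y : 𝒴) (x : Ω) : ℂ :=
  P.VppM h (dom Y) (B Y x)

variable (dom : 𝒴 → C.Dom) (B : (Y : 𝒴) → Ω → P.Arg (dom Y))

/-- [folklore] **`LinearHistoryOn.read` BY CONSTRUCTION**: the read-out IS the CLM family `L Y x := VppCLMM (dom Y) (B Y x)` applied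
to the table. -/
theorem readVpp_eq_clm (h : B13HistM P) (Y : 𝒴) (x : Ω) : readVpp P dom B h Y x = VppCLMM P (dom Y) (B Y x) h := by
  rw [VppCLMM_apply, readVpp]

/-- [folklore] **P2's `ReadAdditive` BY CONSTRUCTION.** -/
theorem readAdditive_readVpp : ReadAdditive (readVpp P dom B) := fun h h' Y x => by
  simp only [readVpp_eq_clm, map_add]

/-- [folklore] **P2's `ReadUnitBound` BY CONSTRUCTION**, with the weights `v Y := ϱ·‖τ Y‖·level136(d (dom Y))` (the (1.36) level
format times the contour weight — the printed KIND of `|τ(Y)||𝐕″_k(Y, B)| ≤ α₄exp(−δκd_k(Y))`, [II] p. 16, not asserted). -/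
theorem readUnitBound_readVpp (D : Finset 𝒴) (τ : 𝒴 → ℂ) {ϱ : ℝ} (hϱ : 0 < ϱ) :
    ReadUnitBound (readVpp P dom B) D τ (fun Y => ϱ * (‖τ Y‖ * level136 P.consts (C.d (dom Y)))) ϱ := by
  intro h Y _ x
  rw [norm_mul, readVpp]
  calc ‖τ Y‖ * ‖P.VppM h (dom Y) (B Y x)‖ ≤ ‖τ Y‖ * (level136 P.consts (C.d (dom Y)) * ‖h‖) :=
        mul_le_mul_of_nonneg_left (P.norm_VppM_le h (dom Y) (B Y x)) (norm_nonneg _)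
    _ = ‖h‖ / ϱ * (ϱ * (‖τ Y‖ * level136 P.consts (C.d (dom Y)))) := by field_simp

/-- [folklore] For measurable field maps the read-out of every MEASURABLE table is measurable in the integration point. -/
theorem measurable_readVpp [MeasurableSpace Ω] (hB : ∀ Y, Measurable (B Y)) (h : B13HistM P) (Y : 𝒴) :
    Measurable fun x => readVpp P dom B h Y x :=
  ((P.mem_measTables.1 h.2).1 (dom Y)).comp (hB Y)

/-! ## §2 The junction's `histm` clause for any term datum reading its history this way -/

variable {Op ι κ S Ω₀ 𝒞 : Type*} [MeasurableSpace Ω] [MeasurableSpace Ω₀]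

/-- [folklore] **`LinearHistoryOn.histm` BY CONSTRUCTION**: if a (2.14)-term datum over the measurable history space reads its history
as `readVpp` along measurable field maps, then `x ↦ histForm y x` is a.e.-strongly measurable for EVERY table `y` and every measure
(here the term's own `ν`). -/
theorem aestronglyMeasurable_histForm (𝔱 : TermDatum Op (B13HistM P) ι κ S Ω Ω₀ 𝒴 𝒞)
    (hread : ∀ h Y x, 𝔱.read h Y x = readVpp P dom B h Y x) (hB : ∀ Y, Measurable (B Y)) (y : B13HistM P) :
    AEStronglyMeasurable (fun x => 𝔱.histForm y x) 𝔱.ν := by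
  have hm : Measurable fun x => ∑ Y ∈ 𝔱.D, 𝔱.τ Y * readVpp P dom B y Y x :=
    Finset.measurable_sum _ fun Y _ => (measurable_readVpp P dom B hB y Y).const_mul _
  have heq : (fun x => 𝔱.histForm y x) = fun x => ∑ Y ∈ 𝔱.D, 𝔱.τ Y * readVpp P dom B y Y x := by
    funext x
    simp only [TermDatum.histForm, histPot, hread]
  rw [heq]
  exact hm.aestronglyMeasurable

/-- [folklore] The size of the history exponent through the table: `‖histForm y x‖ ≤ ‖y‖ · Σ_{Y∈𝐃} ‖τ Y‖·level136(d (dom Y))`,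
uniformly in the integration point. -/
theorem norm_histForm_le (𝔱 : TermDatum Op (B13HistM P) ι κ S Ω Ω₀ 𝒴 𝒞)
    (hread : ∀ h Y x, 𝔱.read h Y x = readVpp P dom B h Y x) (y : B13HistM P) (x : Ω) :
    ‖𝔱.histForm y x‖ ≤ ‖y‖ * ∑ Y ∈ 𝔱.D, ‖𝔱.τ Y‖ * level136 P.consts (C.d (dom Y)) := by
  simp only [TermDatum.histForm, histPot, hread, Finset.mul_sum]
  refine (norm_sum_le _ _).trans (Finset.sum_le_sum fun Y _ => ?_)
  rw [norm_mul, readVpp]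
  calc ‖𝔱.τ Y‖ * ‖P.VppM y (dom Y) (B Y x)‖ ≤ ‖𝔱.τ Y‖ * (level136 P.consts (C.d (dom Y)) * ‖y‖) :=
        mul_le_mul_of_nonneg_left (P.norm_VppM_le y (dom Y) (B Y x)) (norm_nonneg _)
    _ = ‖y‖ * (‖𝔱.τ Y‖ * level136 P.consts (C.d (dom Y))) := by ring

end Summit.QuantumFields.BalabanUV.T4Continuum.B13HistReadout

end
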